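import Mathlib
import Literature.MathematicalPhysics.MHD.GradShafranov
import HarnessLib

/-!
# Flux-surface geometry of an axisymmetric equilibrium: `∂/∂ψ`, `∂/∂l`, curvatures, Mercier's `I(U)` (as printed)

Typed AS PRINTED from J. P. Freidberg, *Ideal MHD* (CUP 2014) §12.3 «The ballooning mode equations for
tokamaks» and §12.5.3 — bib `Freidberg2014`; locators read on the page by the typer (LADDER-GRIDFUSION
seat gridfusion-model-5, 2026-08-26; galaxy panama:388488381857833 c1405000–1466000):

* flux coordinates `(ψ, l, φ)` with `∇l·∇ψ = 0`, `B_p·∇l = B_p` (12.28), Jacobian `J = 1/B_p` (12.31), the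
  orthonormal triad `n = ∇ψ/(RB_p)`, `b`, `t` (12.32);
* hence the two derivative operators used throughout §12.3–12.5 on functions of `(R, Z)`:
  `∂f/∂ψ|_l = (∇ψ·∇f)/|∇ψ|²` and `∂f/∂l|_ψ = (B_p·∇f)/B_p` (consequences of (12.28) recorded here as
  the DEFINITIONS `dPsi`, `dArc` — design choice: no flux-coordinate chart is constructed);
* the perpendicular wave number `k_t = nB/(RB_p)` (12.36) (per toroidal mode number `n`);
* the normal and geodesic curvatures `κ_n = (μ₀RB_p/B²) ∂_ψ(p + B²/2μ₀)`,
  `κ_t = (μ₀F/(RB³)) ∂_l(B²/2μ₀)` (12.39);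
* Mercier's flux-surface functional `I(U) = (1/2π)∮ U dl/(R²B_p³)` (12.84), over a supplied
  parametrisation of the surface (`GradShafranov.loopIntegral`).

PROVED: `B_p² = |∇ψ|²/R²` (consistency of (6.3) with `n = ∇ψ/(RB_p)` (12.32)), and `∂ψ/∂ψ = 1`,
`∂ψ/∂l = 0` where `∇ψ ≠ 0`.
NOT here: `k_n` (12.36) and the local-shear term `∂Q/∂ψ` of (12.84) — they differentiate a running contour
integral across surfaces and need an actual `(ψ, l)` chart (F2 work, see pub/gridfusion/models/F2-SCOPING.md
R3); the ballooning equation (12.40) and all stability statements (lit-3's files `MercierCriterion.lean`,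
which consumes the five `I(U)` values this file's functional produces). HONEST FRAMING: geometry of a MODEL
equilibrium; nothing here is a stability claim.
-/

noncomputable section

namespace Literature.MathematicalPhysics.MHD.FluxGeometry

open GradShafranov _root_.Real

/-- Poloidal-plane inner product of gradients `∇f·∇g = f_R g_R + f_Z g_Z` of two functions of `(R, Z)`.
[cite: Freidberg2014, §6.3.1 eq. (6.17)] -/
def gradDot (f g : ℝ → ℝ → ℝ) (R Z : ℝ) : ℝ := dR f R Z * dR g R Z + dZ f R Z * dZ g R Z

/-- `|∇ψ|² = ψ_R² + ψ_Z²` (`= R²B_p²`). [cite: Freidberg2014, §6.3.1 eq. (6.18)] -/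
def gradSq (ψ : ℝ → ℝ → ℝ) (R Z : ℝ) : ℝ := dR ψ R Z ^ 2 + dZ ψ R Z ^ 2

/-- Consistency of the two printed descriptions of the poloidal field: `B_p² = |∇ψ|²/R²`
(`B_p = (1/R)∇ψ × e_φ` (6.3), `n = ∇ψ/(RB_p)` (12.32)). [cite: Freidberg2014, §12.3 eq. (12.32)] -/
theorem fieldBpol_sq (ψ : ℝ → ℝ → ℝ) (R Z : ℝ) : fieldBpol ψ R Z ^ 2 = gradSq ψ R Z / R ^ 2 := by
  unfold fieldBpol gradSq fieldBR fieldBZ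
  rw [Real.sq_sqrt (by positivity)]
  ring

/-- `∂f/∂ψ` at fixed poloidal arc length `l`, for a function `f` of `(R, Z)`: `(∇ψ·∇f)/|∇ψ|²` — the
flux-coordinate derivative of Freidberg §12.3, where `∇l·∇ψ = 0` (12.28) gives `∇f = f_ψ∇ψ + f_l∇l`
hence `∇ψ·∇f = f_ψ|∇ψ|²`. Junk value where `∇ψ = 0` (the axis): `x/0 = 0`. [cite: Freidberg2014, §12.3 eq. (12.28)] -/
def dPsi (ψ f : ℝ → ℝ → ℝ) (R Z : ℝ) : ℝ := gradDot ψ f R Z / gradSq ψ R Z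

/-- `∂f/∂l` at fixed `ψ` (derivative along the poloidal field direction `b_p = B_p/B_p`, `∇l = b_p` (12.28)):
`(B_R f_R + B_Z f_Z)/B_p`. Junk value where `B_p = 0`. [cite: Freidberg2014, §12.3 eq. (12.28)] -/
def dArc (ψ f : ℝ → ℝ → ℝ) (R Z : ℝ) : ℝ :=
  (fieldBR ψ R Z * dR f R Z + fieldBZ ψ R Z * dZ f R Z) / fieldBpol ψ R Z

/-- `∂ψ/∂ψ = 1` wherever `∇ψ ≠ 0`. [cite: Freidberg2014, §12.3 eq. (12.28)] -/
theorem dPsi_self {ψ : ℝ → ℝ → ℝ} {R Z : ℝ} (h : gradSq ψ R Z ≠ 0) : dPsi ψ ψ R Z = 1 := by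
  unfold dPsi gradDot
  rw [div_eq_one_iff_eq h]
  unfold gradSq; ring

/-- `∂ψ/∂l = 0`: `ψ` is constant along the poloidal field (`B_p·∇ψ = 0`). [cite: Freidberg2014, §12.3 eq. (12.28)] -/
theorem dArc_self (ψ : ℝ → ℝ → ℝ) (R Z : ℝ) : dArc ψ ψ R Z = 0 := by
  unfold dArc fieldBR fieldBZ
  simp only [neg_mul, div_eq_zero_iff]
  left; ring

/-- Total field magnitude `B = (B_φ² + B_p²)^{1/2}` with `B_φ = F(ψ)/R`. [cite: Freidberg2014, §12.3 eq. (12.27)] -/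
def fieldB (F : ℝ → ℝ) (ψ : ℝ → ℝ → ℝ) (R Z : ℝ) : ℝ := Real.sqrt (fieldBsq F ψ R Z)

/-- Perpendicular wave number per toroidal mode number, `k_t/n = B/(RB_p)`. [cite: Freidberg2014, §12.3 eq. (12.36)] -/
def ktOverN (F : ℝ → ℝ) (ψ : ℝ → ℝ → ℝ) (R Z : ℝ) : ℝ := fieldB F ψ R Z / (R * fieldBpol ψ R Z)

/-- Normal curvature AS PRINTED: `κ_n = (μ₀RB_p/B²) ∂/∂ψ (p + B²/2μ₀)` (pressure `p` as a function of
`ψ`). [cite: Freidberg2014, §12.3 eq. (12.39)] -/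
def normalCurvature (μ0 : ℝ) (p F : ℝ → ℝ) (ψ : ℝ → ℝ → ℝ) (R Z : ℝ) : ℝ :=
  μ0 * R * fieldBpol ψ R Z / fieldBsq F ψ R Z *
    dPsi ψ (fun r z => p (ψ r z) + fieldBsq F ψ r z / (2 * μ0)) R Z

/-- Geodesic curvature AS PRINTED: `κ_t = (μ₀F/(RB³)) ∂/∂l (B²/2μ₀)`. [cite: Freidberg2014, §12.3 eq. (12.39)] -/
def geodesicCurvature (μ0 : ℝ) (F : ℝ → ℝ) (ψ : ℝ → ℝ → ℝ) (R Z : ℝ) : ℝ :=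
  μ0 * F (ψ R Z) / (R * fieldB F ψ R Z ^ 3) * dArc ψ (fun r z => fieldBsq F ψ r z / (2 * μ0)) R Z

/-- Mercier's flux-surface functional AS PRINTED: `I(U) = (1/2π) ∮ U dl/(R²B_p³)` over the surface traced
by `γ : [0, T] → (R, Z)` (hypothesis `GradShafranov.IsFluxSurfaceLoop`); feeds `Mercier.mercierD` of
`MercierCriterion.lean` with `U ∈ {1, B², RB_pκ_n, Γ, Γ/B²}`. [cite: Freidberg2014, §12.5.3 eq. (12.84)] -/
def mercierI (ψ : ℝ → ℝ → ℝ) (γ : ℝ → ℝ × ℝ) (T : ℝ) (U : ℝ → ℝ → ℝ) : ℝ :=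
  1 / (2 * π) * loopIntegral γ T (fun R Z => U R Z / (R ^ 2 * fieldBpol ψ R Z ^ 3))

/-- The pressure-gradient part of Mercier's `Γ` AS PRINTED, `Γ = F(μ₀Fp′ − R²B_p³ ∂Q/∂ψ)`, with the
local-shear value `∂Q/∂ψ` SUPPLIED as an input function `dQ` (its construction needs a `(ψ,l)` chart — not
in this file). [cite: Freidberg2014, §12.5.3 eq. (12.84)] -/
def mercierGamma (μ0 : ℝ) (pprime F : ℝ → ℝ) (ψ : ℝ → ℝ → ℝ) (dQ : ℝ → ℝ → ℝ) (R Z : ℝ) : ℝ :=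
  F (ψ R Z) * (μ0 * F (ψ R Z) * pprime (ψ R Z) - R ^ 2 * fieldBpol ψ R Z ^ 3 * dQ R Z)

end Literature.MathematicalPhysics.MHD.FluxGeometry

namespace Literature.MathematicalPhysics.MHD.FluxGeometry

open GradShafranov _root_.Real

/-! ## Euclidean-speed variant of Mercier's `I(U)` (append 2026-08-26, LADDER-GRIDFUSION RULING 15)

`mercierI` above is built on `GradShafranov.loopIntegral`, whose `‖deriv γ t‖` is Mathlib's PRODUCT (sup)
norm on `ℝ × ℝ` — not the book's arc length. It is kept (append-only tree) and SUPERSEDED by `mercierIE`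
below, built on `GradShafranov.loopIntegralE` (Euclidean speed `√(R′² + Z′²)`). -/

/-- Mercier's flux-surface functional AS PRINTED, `I(U) = (1/2π) ∮ U dl/(R²B_p³)`, with EUCLIDEAN arc
length (`GradShafranov.loopIntegralE`) over the surface traced by `γ : [0, T] → (R, Z)`. Supersedes
`mercierI`. [cite: Freidberg2014, §12.5.3 eq. (12.84)] -/
def mercierIE (ψ : ℝ → ℝ → ℝ) (γ : ℝ → ℝ × ℝ) (T : ℝ) (U : ℝ → ℝ → ℝ) : ℝ :=
  1 / (2 * π) * loopIntegralE γ T (fun R Z => U R Z / (R ^ 2 * fieldBpol ψ R Z ^ 3))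


/-! ## Third-order axis jets (for near-axis expansions of the flux surfaces, e.g. Bateman 1978 §7.3 (7.3.3)) -/

/-- `∂³ψ/∂R³` at `(R, Z)` (`iteratedDeriv 3` in the first slot). [folklore] -/
def dRRR (ψ : ℝ → ℝ → ℝ) (R Z : ℝ) : ℝ := iteratedDeriv 3 (fun r => ψ r Z) R

/-- `∂³ψ/∂Z³` at `(R, Z)` (`iteratedDeriv 3` in the second slot). [folklore] -/
def dZZZ (ψ : ℝ → ℝ → ℝ) (R Z : ℝ) : ℝ := iteratedDeriv 3 (ψ R) Z

/-- Mixed jet `∂_R ∂²_Z ψ` at `(R, Z)`: the `R`-derivative of `dZZ ψ (·, Z)`. [folklore] -/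
def dRZZ (ψ : ℝ → ℝ → ℝ) (R Z : ℝ) : ℝ := deriv (fun r => dZZ ψ r Z) R

/-- Mixed jet `∂_Z ∂²_R ψ` at `(R, Z)`: the `Z`-derivative of `dRR ψ (R, ·)`. [folklore] -/
def dZRR (ψ : ℝ → ℝ → ℝ) (R Z : ℝ) : ℝ := deriv (fun z => dRR ψ R z) Z

end Literature.MathematicalPhysics.MHD.FluxGeometry

namespace Literature.MathematicalPhysics.MHD.FluxGeometry

open GradShafranov _root_.Real

/-! ## Mixed second-order jets and `B²` for a constant free function (append 2026-08-26, g2)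

The curvature `κ_n` (12.39) differentiates `B² = (F² + |∇ψ|²)/R²`, whose gradient involves the MIXED second
derivative `ψ_RZ`; these plumbing definitions / identities complete the second-order vocabulary
(`dRR`, `dZZ` live in `GradShafranov.lean`). -/

/-- Mixed second derivative `∂_Z ∂_R ψ` at `(R, Z)`: the `Z`-derivative of `dR ψ (R, ·)`. [folklore] -/
def dRZ (ψ : ℝ → ℝ → ℝ) (R Z : ℝ) : ℝ := deriv (fun z => dR ψ R z) Z

/-- Mixed second derivative `∂_R ∂_Z ψ` at `(R, Z)`: the `R`-derivative of `dZ ψ (·, Z)`. [folklore] -/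
def dZR (ψ : ℝ → ℝ → ℝ) (R Z : ℝ) : ℝ := deriv (fun r => dZ ψ r Z) R

/-- For a CONSTANT free function `F(ψ) ≡ F` (e.g. Solov'ev profiles with `FF′ = 0`):
`B² = (F² + |∇ψ|²)/R²` at `R ≠ 0` (from `B_φ = F/R` (6.11) and `B_p² = |∇ψ|²/R²` (12.32)).
[cite: Freidberg2014, §12.3 eq. (12.32)] -/
theorem fieldBsq_const {F : ℝ} (ψ : ℝ → ℝ → ℝ) {R : ℝ} (Z : ℝ) (hR : R ≠ 0) :
    fieldBsq (fun _ => F) ψ R Z = (F ^ 2 + gradSq ψ R Z) / R ^ 2 := by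
  unfold fieldBsq fieldBphi fieldBR fieldBZ gradSq
  field_simp
  ring

end Literature.MathematicalPhysics.MHD.FluxGeometry
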